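import Mathlib
import Summits.ResolutionOfSingularities.ResolutionOfSingularities.Theorems.HomologicalConductorPersistenceKC3ChartClosedForm
import HarnessLib

/-!
# Crux `Persistence` (stmt-ResolutionOfSingularities-16484), KILL CANDIDATE K-C3, piece K3b-N (2/2):
# the `x`-chart `W = k[x, z, t, z²/x, zt/x, t²/x, z³/x²]` of the cusp threefold IS INTEGRALLY CLOSED

Route `ResolutionOfSingularities/HomologicalConductor`, chain w44b (CHAIN v13.2 §V13.10, REFEREE-KC3 L5).
[OURS · L1 w44b] — AI-written, weaker than expert review; not a statement of any manuscript under review.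

`K := FractionRing (MvPolynomial (Fin 3) k)`, `x, z, t := X 0, X 1, X 2`, `W := k[x, z, t, z²x⁻¹, ztx⁻¹, t²x⁻¹, z³x⁻¹x⁻¹]`
(generator set spelled exactly as in `…PersistenceKC3TowerInstance.kc3_tower_one_eq`).  Using the closed form of part 1
(`…PersistenceKC3ChartClosedForm.mem_W_iff`: `W = {g·(x⁻¹)^m : 6m ≤ ν_w(g)}`, `ν_w = monomialOrd ![6,4,3]`):

* `mem_W_of_isIntegral` — **every `y ∈ K` integral over `W` lies in `W`**: writing the coefficients of a monic relation
  as `cᵢ = gᵢ·(x⁻¹)^{mᵢ}` and `M = Σ mᵢ`, `x^M y` is integral over `k[x,z,t]`, which is integrally closed (UFD) with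
  fraction field `K`, so `x^M y = G ∈ k[x,z,t]`; and `6M ≤ ν_w(G)` by the LOWEST-WEIGHT argument on the cleared relation
  `Gⁿ x^M = −Σ_{i<n} gᵢ Gⁱ x^{M(n−i)+(M−mᵢ)}` (`ν_w` is additive on products over the domain `k[x,z,t]` and super-additive on
  sums; `ν_w(G) < 6M` would make the left side strictly lighter than every term on the right);
* `isIntegrallyClosed_W` — **`W` is an integrally closed domain** (`Frac W = K`).

This discharges the hypothesis `hnrm : nrm (loc O W) ≤ loc O W` of the K3b tower step (res-D-pv-043, p528915
`…PersistenceKC3TowerInstance.kc3_tower_one_eq`): see the companion `…PersistenceKC3NormalLoc` (localisation at the centre of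
a valuation ring preserves normality).  Valuation-free, fact-free.

References: W. Bruns, J. Herzog, *Cohen–Macaulay rings*, CUP 1998 (rev. ed.), Prop. 6.1.2 [BrunsHerzog1998]; H. Matsumura,
*Commutative Ring Theory*, CUP 1986, §9 (UFDs, hence polynomial rings, are normal) [Matsumura1987].
-/

-- single-problem summit: the doubled namespace component `ResolutionOfSingularities` is forced
set_option linter.dupNamespace false

noncomputable section

namespace Summit.ResolutionOfSingularities.ResolutionOfSingularities.Theorems.HomologicalConductor.PersistenceKC3Normal

open MvPolynomial Literature.AlgebraicGeometry.Resolution.WeightedBlowup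
open Summit.ResolutionOfSingularities.ResolutionOfSingularities.Theorems.HomologicalConductor.PersistenceKC3ChartClosedForm

variable {k : Type} [Field k]

local notation3 "𝕂" => FractionRing (MvPolynomial (Fin 3) k)
local notation3 "ι" => algebraMap (MvPolynomial (Fin 3) k) (FractionRing (MvPolynomial (Fin 3) k))
local notation3 "𝔵" => algebraMap (MvPolynomial (Fin 3) k) (FractionRing (MvPolynomial (Fin 3) k)) (MvPolynomial.X 0)
local notation3 "𝔷" => algebraMap (MvPolynomial (Fin 3) k) (FractionRing (MvPolynomial (Fin 3) k)) (MvPolynomial.X 1)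
local notation3 "𝔱" => algebraMap (MvPolynomial (Fin 3) k) (FractionRing (MvPolynomial (Fin 3) k)) (MvPolynomial.X 2)
/-- The chart ring `W = k[x, z, t, z²x⁻¹, ztx⁻¹, t²x⁻¹, z³x⁻¹x⁻¹] ⊆ k(x,z,t)` — the generator set is spelled EXACTLY as in
`…PersistenceKC3TowerInstance.kc3_tower_one_eq` (res-D-pv-043) at `x z t := ι X₀, ι X₁, ι X₂` (local notation only). -/
local notation3 "𝕎" => Algebra.adjoin k
  ({algebraMap (MvPolynomial (Fin 3) k) (FractionRing (MvPolynomial (Fin 3) k)) (MvPolynomial.X 0),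
    algebraMap (MvPolynomial (Fin 3) k) (FractionRing (MvPolynomial (Fin 3) k)) (MvPolynomial.X 1),
    algebraMap (MvPolynomial (Fin 3) k) (FractionRing (MvPolynomial (Fin 3) k)) (MvPolynomial.X 2),
    algebraMap (MvPolynomial (Fin 3) k) (FractionRing (MvPolynomial (Fin 3) k)) (MvPolynomial.X 1) ^ 2 *
      (algebraMap (MvPolynomial (Fin 3) k) (FractionRing (MvPolynomial (Fin 3) k)) (MvPolynomial.X 0))⁻¹,
    algebraMap (MvPolynomial (Fin 3) k) (FractionRing (MvPolynomial (Fin 3) k)) (MvPolynomial.X 1) *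
      algebraMap (MvPolynomial (Fin 3) k) (FractionRing (MvPolynomial (Fin 3) k)) (MvPolynomial.X 2) *
      (algebraMap (MvPolynomial (Fin 3) k) (FractionRing (MvPolynomial (Fin 3) k)) (MvPolynomial.X 0))⁻¹,
    algebraMap (MvPolynomial (Fin 3) k) (FractionRing (MvPolynomial (Fin 3) k)) (MvPolynomial.X 2) ^ 2 *
      (algebraMap (MvPolynomial (Fin 3) k) (FractionRing (MvPolynomial (Fin 3) k)) (MvPolynomial.X 0))⁻¹,
    algebraMap (MvPolynomial (Fin 3) k) (FractionRing (MvPolynomial (Fin 3) k)) (MvPolynomial.X 1) ^ 3 *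
      (algebraMap (MvPolynomial (Fin 3) k) (FractionRing (MvPolynomial (Fin 3) k)) (MvPolynomial.X 0))⁻¹ *
      (algebraMap (MvPolynomial (Fin 3) k) (FractionRing (MvPolynomial (Fin 3) k)) (MvPolynomial.X 0))⁻¹} :
    Set (FractionRing (MvPolynomial (Fin 3) k)))

/-- The weights `(6, 4, 3)` of `x, z, t` (local notation only). -/
local notation3 "𝕨" => (![6, 4, 3] : Fin 3 → ℕ)

/-! ## Weighted-order bookkeeping on `k[x,z,t]` -/

/-- `ν_w(Gⁿ) = n • ν_w(G)` (`k[x,z,t]` is a domain). [folklore] -/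
theorem monomialOrd_pow (G : MvPolynomial (Fin 3) k) (n : ℕ) :
    monomialOrd 𝕨 (G ^ n) = n • monomialOrd 𝕨 G := by
  induction n with
  | zero => rw [pow_zero, zero_nsmul, ← C_1, monomialOrd_C _ one_ne_zero]
  | succ n ih => rw [pow_succ, monomialOrd_mul, ih, succ_nsmul]

/-- `ν_w(−F) = ν_w(F)`. [folklore] -/
theorem monomialOrd_neg (F : MvPolynomial (Fin 3) k) : monomialOrd 𝕨 (-F) = monomialOrd 𝕨 F := by
  rw [show -F = C (-1 : k) * F by rw [map_neg, C_1, neg_one_mul], monomialOrd_mul,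
    monomialOrd_C _ (neg_ne_zero.mpr one_ne_zero), zero_add]

/-- A finite sum all of whose terms are strictly heavier than `c` is strictly heavier than `c`. [folklore] -/
theorem lt_monomialOrd_sum {α : Type} (s : Finset α) (T : α → MvPolynomial (Fin 3) k) (c : ℕ)
    (h : ∀ i ∈ s, (c : ℕ∞) < monomialOrd 𝕨 (T i)) : (c : ℕ∞) < monomialOrd 𝕨 (∑ i ∈ s, T i) := by
  classical
  induction s using Finset.induction_on with
  | empty => rw [Finset.sum_empty, monomialOrd_zero]; exact ENat.coe_lt_top c
  | insert a s ha ih =>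
    rw [Finset.sum_insert ha]
    refine lt_of_lt_of_le ?_ (min_monomialOrd_le_add _ _ _)
    exact lt_min (h a (Finset.mem_insert_self a s))
      (ih fun i hi => h i (Finset.mem_insert_of_mem hi))

/-- Exponent bookkeeping in `K`: `e + a = b ⟹ x^e = x^b · (x⁻¹)^a`. [folklore] -/
theorem x_pow_eq_of_add_eq {e a b : ℕ} (h : e + a = b) : (𝔵 : 𝕂) ^ e = 𝔵 ^ b * 𝔵⁻¹ ^ a := by
  rw [← h, pow_add, mul_assoc, ← mul_pow, mul_inv_cancel₀ x_ne_zero, one_pow, mul_one]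

/-! ## `W` is integrally closed -/

/-- **`W` is integrally closed in `K`.** If `y ∈ K` is integral over `W`, write the coefficients of a monic
relation as `cᵢ = gᵢ · (x⁻¹)^{mᵢ}` (`6mᵢ ≤ ν_w(gᵢ)`, closed form) and `M = Σ mᵢ`; then `x^M y` is integral over
`k[x,z,t]`, which is integrally closed (UFD) with fraction field `K`, so `x^M y = G ∈ k[x,z,t]`; finally
`6M ≤ ν_w(G)` — otherwise, in the cleared relation `Gⁿ x^M = −Σ_{i<n} gᵢ Gⁱ x^{Mi + M(n−i) + (M − mᵢ)}` in
`k[x,z,t]`, the left side has weight `n ν_w(G) + 6M`, strictly less than the weight of every term on the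
right — impossible since `ν_w` is super-additive. Hence `y = G · (x⁻¹)^M ∈ W`.
[cite: BrunsHerzog1998, Prop. 6.1.2] [cite: Matsumura1987, Thm. 9.1 ff. (normality of polynomial rings)] -/
theorem mem_W_of_isIntegral (y : 𝕂) (hy : IsIntegral ↥𝕎 y) : y ∈ 𝕎 := by
  haveI : IsIntegrallyClosed (MvPolynomial (Fin 3) k) := UniqueFactorizationMonoid.instIsIntegrallyClosed
  have hx : (𝔵 : 𝕂) ≠ 0 := x_ne_zero
  obtain ⟨p, hmonic, heval⟩ := hy
  set n := p.natDegree with hn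
  -- the monic relation `yⁿ = -Σ_{i<n} cᵢ yⁱ`
  have hrel : y ^ n = -∑ i ∈ Finset.range n, ((p.coeff i : ↥𝕎) : 𝕂) * y ^ i := by
    rw [Polynomial.eval₂_eq_sum_range, Finset.sum_range_succ, hmonic.coeff_natDegree, map_one, one_mul]
      at heval
    exact eq_neg_of_add_eq_zero_right heval
  -- closed form of the coefficients
  have hc : ∀ i : ℕ, ∃ (g : MvPolynomial (Fin 3) k) (m : ℕ), ((6 * m : ℕ) : ℕ∞) ≤ monomialOrd 𝕨 g ∧
      ((p.coeff i : ↥𝕎) : 𝕂) = ι g * 𝔵⁻¹ ^ m := fun i => exists_laurent_of_mem (p.coeff i).2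
  choose g m hgw hgc using hc
  set M := ∑ i ∈ Finset.range n, m i with hM
  have hmM : ∀ i ∈ Finset.range n, m i ≤ M := fun i hi =>
    Finset.single_le_sum (f := m) (fun j _ => Nat.zero_le _) hi
  -- `x^M y` is integral over `k[x,z,t]`
  have hint : IsIntegral (MvPolynomial (Fin 3) k) ((𝔵 : 𝕂) ^ M * y) := by
    refine ⟨Polynomial.X ^ n +
        ∑ i : Fin n, Polynomial.C (g i * X 0 ^ (M * (n - i) - m i)) * Polynomial.X ^ (i : ℕ),
      Polynomial.monic_X_pow_add (Polynomial.degree_sum_fin_lt _), ?_⟩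
    rw [Polynomial.eval₂_add, Polynomial.eval₂_X_pow, Polynomial.eval₂_finsetSum]
    simp only [Polynomial.eval₂_mul, Polynomial.eval₂_C, Polynomial.eval₂_X_pow]
    rw [Fin.sum_univ_eq_sum_range (fun i => ι (g i * X 0 ^ (M * (n - i) - m i)) * (𝔵 ^ M * y) ^ i) n]
    have hterm : ∀ i ∈ Finset.range n,
        ι (g i * X 0 ^ (M * (n - i) - m i)) * ((𝔵 : 𝕂) ^ M * y) ^ i =
          𝔵 ^ (M * n) * (((p.coeff i : ↥𝕎) : 𝕂) * y ^ i) := by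
      intro i hi
      have hi' : i < n := Finset.mem_range.mp hi
      have h1 : m i ≤ M * (n - i) :=
        le_trans (hmM i hi) (Nat.le_mul_of_pos_right M (by omega))
      have h2 : M * (n - i) + M * i = M * n := by rw [← mul_add, Nat.sub_add_cancel hi'.le]
      have hexp : (M * i + (M * (n - i) - m i)) + m i = M * n := by
        generalize M * (n - i) = A at h1 h2 ⊢
        generalize M * i = B at h2 ⊢
        omega
      have hpow : (𝔵 : 𝕂) ^ (M * i) * 𝔵 ^ (M * (n - i) - m i) = 𝔵 ^ (M * n) * 𝔵⁻¹ ^ m i := by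
        rw [← pow_add, x_pow_eq_of_add_eq hexp]
      calc ι (g i * X 0 ^ (M * (n - i) - m i)) * ((𝔵 : 𝕂) ^ M * y) ^ i
          = ι (g i) * ((𝔵 : 𝕂) ^ (M * i) * 𝔵 ^ (M * (n - i) - m i)) * y ^ i := by
            rw [map_mul, map_pow, mul_pow, ← pow_mul]; ring
        _ = ι (g i) * ((𝔵 : 𝕂) ^ (M * n) * 𝔵⁻¹ ^ m i) * y ^ i := by rw [hpow]
        _ = _ := by rw [hgc i]; ring
    rw [Finset.sum_congr rfl hterm, ← Finset.mul_sum, mul_pow, ← pow_mul, hrel]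
    ring
  -- hence `x^M y = G` is a polynomial
  obtain ⟨G, hG⟩ := IsIntegrallyClosed.isIntegral_iff.mp hint
  have hyG : y = ι G * 𝔵⁻¹ ^ M := by
    rw [hG, mul_comm (𝔵 ^ M) y, mul_assoc, ← mul_pow, mul_inv_cancel₀ hx, one_pow, mul_one]
  rw [hyG]
  apply mem_of_laurent
  -- the weight inequality `6M ≤ ν_w(G)`, by the lowest-weight argument
  by_contra hlt
  rw [not_le] at hlt
  have hGtop : monomialOrd 𝕨 G ≠ ⊤ := ne_top_of_lt hlt
  obtain ⟨a, ha⟩ : ∃ a : ℕ, monomialOrd 𝕨 G = a := ⟨_, (ENat.coe_toNat hGtop).symm⟩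
  rw [ha, Nat.cast_lt] at hlt
  -- the cleared relation in `k[x,z,t]`
  let T : ℕ → MvPolynomial (Fin 3) k := fun i => g i * G ^ i * X 0 ^ (M * (n - i) + (M - m i))
  have hid : G ^ n * X 0 ^ M = -∑ i ∈ Finset.range n, T i := by
    apply algebraMap_injective
    have hL : ι (G ^ n * X 0 ^ M) = (𝔵 : 𝕂) ^ (M * n + M) * y ^ n := by
      rw [map_mul, map_pow, map_pow, hG, mul_pow, ← pow_mul, pow_add]; ring
    have hR : ∀ i ∈ Finset.range n,
        ι (T i) = (𝔵 : 𝕂) ^ (M * n + M) * (((p.coeff i : ↥𝕎) : 𝕂) * y ^ i) := by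
      intro i hi
      have hi' : i < n := Finset.mem_range.mp hi
      have h2 : M * (n - i) + M * i = M * n := by rw [← mul_add, Nat.sub_add_cancel hi'.le]
      have hexp : (M * i + (M * (n - i) + (M - m i))) + m i = M * n + M := by
        have := hmM i hi
        generalize M * (n - i) = A at h2 ⊢
        generalize M * i = B at h2 ⊢
        omega
      have hpow : (𝔵 : 𝕂) ^ (M * i) * 𝔵 ^ (M * (n - i) + (M - m i)) = 𝔵 ^ (M * n + M) * 𝔵⁻¹ ^ m i := by
        rw [← pow_add, x_pow_eq_of_add_eq hexp]
      calc ι (T i) = ι (g i) * ((𝔵 : 𝕂) ^ (M * i) * 𝔵 ^ (M * (n - i) + (M - m i))) * y ^ i := by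
            simp only [T, map_mul, map_pow, hG, mul_pow, ← pow_mul]; ring
        _ = ι (g i) * ((𝔵 : 𝕂) ^ (M * n + M) * 𝔵⁻¹ ^ m i) * y ^ i := by rw [hpow]
        _ = _ := by rw [hgc i]; ring
    rw [hL, map_neg, map_sum, Finset.sum_congr rfl hR, ← Finset.mul_sum, hrel]
    ring
  -- weights: left side `n a + 6M`, every right-hand term strictly heavier
  have hLw : monomialOrd 𝕨 (G ^ n * X 0 ^ M) = ((n * a + 6 * M : ℕ) : ℕ∞) := by
    rw [monomialOrd_mul, monomialOrd_pow, ha, monomialOrd_X_zero_pow]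
    push_cast
    rw [nsmul_eq_mul]
  have hRw : ∀ i ∈ Finset.range n, ((n * a + 6 * M : ℕ) : ℕ∞) < monomialOrd 𝕨 (T i) := by
    intro i hi
    have hi' : i < n := Finset.mem_range.mp hi
    have hmi := hmM i hi
    simp only [T]
    rw [monomialOrd_mul, monomialOrd_mul, monomialOrd_pow, ha, monomialOrd_X_zero_pow]
    -- `n a + 6M < 6 mᵢ + i a + 6 (M(n-i) + (M - mᵢ)) ≤ ν(gᵢ) + i a + 6(…)`
    have key : n * a + 6 * M < 6 * m i + (i * a + 6 * (M * (n - i) + (M - m i))) := by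
      obtain ⟨d, hd⟩ : ∃ d, n = i + d := ⟨n - i, by omega⟩
      obtain ⟨r, hr⟩ : ∃ r, M = m i + r := ⟨M - m i, by omega⟩
      have hd1 : 1 ≤ d := by omega
      rw [hd, Nat.add_sub_cancel_left, hr, Nat.add_sub_cancel_left]
      have h3 : a * d < 6 * (m i + r) * d := Nat.mul_lt_mul_of_pos_right (by omega) (by omega)
      nlinarith [h3]
    calc ((n * a + 6 * M : ℕ) : ℕ∞)
        < ((6 * m i + (i * a + 6 * (M * (n - i) + (M - m i))) : ℕ) : ℕ∞) := by
          exact_mod_cast key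
      _ = ((6 * m i : ℕ) : ℕ∞) + ((i • (a : ℕ∞)) + ((6 * (M * (n - i) + (M - m i)) : ℕ) : ℕ∞)) := by
          push_cast; rw [nsmul_eq_mul]
      _ ≤ monomialOrd 𝕨 (g i) + ((i • (a : ℕ∞)) + ((6 * (M * (n - i) + (M - m i)) : ℕ) : ℕ∞)) :=
          add_le_add (hgw i) le_rfl
      _ = _ := by rw [add_assoc]
  have hlt' := lt_monomialOrd_sum (Finset.range n) T (n * a + 6 * M) hRw
  rw [← monomialOrd_neg, ← hid, hLw] at hlt'
  exact lt_irrefl _ hlt'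

/-- **`W = k[x, z, t, z²/x, zt/x, t²/x, z³/x²]` is an integrally closed domain** (normal), with fraction field
`K = k(x,z,t)`. [cite: BrunsHerzog1998, Prop. 6.1.2] -/
theorem isIntegrallyClosed_W : IsIntegrallyClosed ↥𝕎 := by
  haveI := isFractionRing_W (k := k)
  exact (isIntegrallyClosed_iff 𝕂).mpr fun {y} hy => ⟨⟨y, mem_W_of_isIntegral y hy⟩, rfl⟩

end Summit.ResolutionOfSingularities.ResolutionOfSingularities.Theorems.HomologicalConductor.PersistenceKC3Normal

end
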